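import Literature.NumberTheory.Sieve.AffineLatticeParametrisation
import Literature.NumberTheory.Sieve.LinearEquationsInPrimesMultiplicativity
import HarnessLib

/-!
# Local densities of an affine lattice `{Ax = b}` equal the local factors of its parametrisation (Green–Tao 2010, §4, derivation of Theorem 1.8) — module M1c of rung F-CS1-eq

Topic `Literature/NumberTheory/Sieve`. Source: B. Green, T. Tao, *Linear equations in primes*,
Ann. of Math. 171 (2010), Thm. 1.8 and §4 (arXiv:math/0606088 pp. 8, 11): "`α_p := lim_{M→∞}
𝔼_{x ∈ [−M,M]^t, Ax = b} ∏_{i∈[t]} Λ_{ℤ_p}(xᵢ)` … The full rank of `A` also ensures that the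
map `Ψ : ℤ^d → Γ` is bijective and it is not hard to see that this implies `α_p = β_p`" (`β_p` the
local factor (1.6) of the parametrising system `Ψ`).

The local density `α_m` (any modulus `m ≥ 1`) is the average of `x ↦ ∏ᵢ Λ_{ℤ/mℤ}(xᵢ)` over the
affine lattice `Γ = {x ∈ ℤ^t : Ax = b}`; the integrand is `mℤ^t`-periodic, so this is the average
over the (finite) image `Γ_m ⊆ (ℤ/mℤ)^t` of `Γ`, which we take as the definition
(`equationResidues`, `equationLocalFactor`; Green–Tao's box limit computes the same number by
periodicity). This file proves:

* `dvd_paramPoint_sub_iff`: `Ψ(c) ≡ Ψ(c') (mod m)` iff `c ≡ c' (mod m)` — the kernel lattice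
  `Λ₀(A) = ker A ∩ ℤ^t` is saturated (`Λ₀ ∩ mℤ^t = mΛ₀`), so reduction mod `m` of the
  parametrisation `Ψ = paramPoint A x₀` (file `AffineLatticeParametrisation`) is injective on
  `(ℤ/mℤ)^{kerDim A}`;
* **`equationLocalFactor_eq_localFactor`**: `α_m(A, b) = β_m(Ψ)` for every base point `x₀ ∈ Γ` and
  every `m ≥ 1` (bijection `(ℤ/mℤ)^{kerDim A} → Γ_m`);
* `equationSingularProduct A b = singularProduct Ψ` (`∏_p α_p = ∏_p β_p` as ordered limits,
  D-SIEVE-1 convention).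

## References

* [GreenTao2010] B. Green, T. Tao, *Linear equations in primes*, Ann. of Math. (2) 171 (2010),
  Thm. 1.8, §4 (derivation of Thm. 1.8), (1.5)–(1.7).
-/

noncomputable section

open Finset Filter
open scoped Matrix

namespace Literature.NumberTheory.Sieve

variable {s t : ℕ}

/-! ### Periodicity of `Λ_{ℤ/mℤ}` -/

/-- `Λ_{ℤ/mℤ}` is `m`-periodic. [cite: GreenTao2010, (1.5)] -/
theorem localVonMangoldt_congr {m : ℕ} {b b' : ℤ} (h : (m : ℤ) ∣ b' - b) :
    localVonMangoldt m b = localVonMangoldt m b' := by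
  rw [localVonMangoldt_eq_zmod, localVonMangoldt_eq_zmod,
    (ZMod.intCast_eq_intCast_iff_dvd_sub b b' m).mpr h]

/-! ### Saturation: reduction mod `m` of the parametrisation is injective -/

/-- [cite: GreenTao2010, §4 (derivation of Thm. 1.8)] -/
theorem paramPoint_sub_paramPoint (A : Matrix (Fin s) (Fin t) ℤ) (x₀ : Fin t → ℤ)
    (c c' : Fin (kerDim A) → ℤ) :
    paramPoint A x₀ c - paramPoint A x₀ c' = ∑ j, (c j - c' j) • kerGen A j := by
  unfold paramPoint
  simp only [sub_smul, Finset.sum_sub_distrib]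
  abel

/-- **`Ψ(c) ≡ Ψ(c') (mod m)` iff `c ≡ c' (mod m)`** (`m ≠ 0`): the kernel lattice is saturated
(`Λ₀ ∩ mℤ^t = mΛ₀`, as `A(mz) = 0 ⇒ Az = 0`) and `v₁, …, v_n` is a `ℤ`-basis of it.
[cite: GreenTao2010, §4 (derivation of Thm. 1.8)] -/
theorem dvd_paramPoint_sub_iff (A : Matrix (Fin s) (Fin t) ℤ) (x₀ : Fin t → ℤ) {m : ℤ}
    (hm : m ≠ 0) (c c' : Fin (kerDim A) → ℤ) :
    (∀ i, m ∣ paramPoint A x₀ c i - paramPoint A x₀ c' i) ↔ ∀ j, m ∣ c j - c' j := by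
  constructor
  · intro h
    choose z hz using h
    -- `m • z = Ψ(c) - Ψ(c') ∈ Λ₀`, hence `z ∈ Λ₀`
    have hmz : m • (z : Fin t → ℤ) = ∑ j, (c j - c' j) • kerGen A j := by
      rw [← paramPoint_sub_paramPoint]
      funext i
      rw [Pi.smul_apply, smul_eq_mul, Pi.sub_apply, hz i]
    have hzmem : (z : Fin t → ℤ) ∈ kerLattice A := by
      refine mem_kerLattice_of_smul_mem hm ?_
      rw [hmz]
      exact Submodule.sum_mem _ fun j _ => Submodule.smul_mem _ _ (kerGen_mem A j)
    obtain ⟨e, he⟩ := exists_sum_smul_kerGen_eq hzmem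
    -- compare coefficients along the `ℤ`-basis
    have hzero : ∑ j, (c j - c' j - m * e j) • kerGen A j = 0 := by
      simp only [sub_smul, Finset.sum_sub_distrib, mul_smul]
      rw [← Finset.smul_sum, he, hmz]
      simp only [sub_smul, Finset.sum_sub_distrib, sub_self]
    have hli := Fintype.linearIndependent_iff.mp (linearIndependent_kerGen A) _ hzero
    intro j
    exact ⟨e j, by linear_combination hli j⟩
  · intro h i
    rw [← Pi.sub_apply, paramPoint_sub_paramPoint, Finset.sum_apply]
    exact Finset.dvd_sum fun j _ => by
      rw [Pi.smul_apply, smul_eq_mul]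
      exact Dvd.dvd.mul_right (h j) _

/-! ### The residues `Γ_m` of the affine lattice and the local densities `α_m` -/

open Classical in
/-- `Γ_m`: the residues (represented in `{0, …, m-1}^t`) of the points of the affine lattice
`Γ = {x ∈ ℤ^t : Ax = b}`. [cite: GreenTao2010, Thm. 1.8 (definition of α_p)] -/
def equationResidues (A : Matrix (Fin s) (Fin t) ℤ) (b : Fin s → ℤ) (m : ℕ) : Finset (Fin t → ℕ) :=
  (Fintype.piFinset fun _ : Fin t => range m).filter
    fun y => ∃ x : Fin t → ℤ, A *ᵥ x = b ∧ ∀ i, (m : ℤ) ∣ x i - y i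

open Classical in
/-- **The local density `α_m = 𝔼_{x ∈ Γ} ∏ᵢ Λ_{ℤ/mℤ}(xᵢ)`** of the affine lattice `Γ = {Ax = b}`,
as the average over its residues `Γ_m` (the integrand is `mℤ^t`-periodic; Green–Tao write it as
the limit of the averages over `Γ ∩ [−M, M]^t`). Junk value `0` when `Γ_m = ∅`.
[cite: GreenTao2010, Thm. 1.8 (definition of α_p)] -/
def equationLocalFactor (A : Matrix (Fin s) (Fin t) ℤ) (b : Fin s → ℤ) (m : ℕ) : ℝ :=
  (#(equationResidues A b m) : ℝ)⁻¹ *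
    ∑ y ∈ equationResidues A b m, ∏ i, localVonMangoldt m (y i : ℤ)

/-- Ordered partial product `∏_{p ≤ x} α_p` (D-SIEVE-1). [cite: GreenTao2010, Thm. 1.8] -/
def equationSingularProductPartial (A : Matrix (Fin s) (Fin t) ℤ) (b : Fin s → ℤ) (x : ℕ) : ℝ :=
  ∏ p ∈ Nat.primesLE x, equationLocalFactor A b p

/-- **`∏_p α_p`**, as an ordered limit (D-SIEVE-1, as for `singularProduct`).
[cite: GreenTao2010, Thm. 1.8] -/
def equationSingularProduct (A : Matrix (Fin s) (Fin t) ℤ) (b : Fin s → ℤ) : ℝ :=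
  limUnder atTop (equationSingularProductPartial A b)

/-! ### `α_m = β_m(Ψ)` -/

/-- Reduction of the parametrisation to residues in `{0, …, m-1}^t`.
[cite: GreenTao2010, §4 (derivation of Thm. 1.8)] -/
def paramResidue (A : Matrix (Fin s) (Fin t) ℤ) (x₀ : Fin t → ℤ) (m : ℕ)
    (n : Fin (kerDim A) → ℕ) : Fin t → ℕ :=
  fun i => ((paramPoint A x₀ (fun j => (n j : ℤ)) i) % (m : ℤ)).toNat

/-- `x mod m`, read back from its `ℕ` representative. [folklore] -/
private theorem toNat_emod_cast {m : ℕ} (hm : 0 < m) (x : ℤ) :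
    (((x % (m : ℤ)).toNat : ℕ) : ℤ) = x % (m : ℤ) :=
  Int.toNat_of_nonneg (Int.emod_nonneg _ (by exact_mod_cast hm.ne'))

/-- `x mod m < m`. [folklore] -/
private theorem toNat_emod_lt {m : ℕ} (hm : 0 < m) (x : ℤ) : (x % (m : ℤ)).toNat < m := by
  have h := Int.emod_lt_of_pos x (show (0 : ℤ) < m by exact_mod_cast hm)
  have h0 := Int.emod_nonneg x (show (m : ℤ) ≠ 0 by exact_mod_cast hm.ne')
  omega

/-- `m ∣ x - (x mod m)`. [folklore] -/
private theorem dvd_sub_emod (m x : ℤ) : m ∣ x - x % m :=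
  Int.modEq_iff_dvd.mp (Int.mod_modEq x m)

/-- [cite: GreenTao2010, §4 (derivation of Thm. 1.8)] -/
theorem paramResidue_cast {A : Matrix (Fin s) (Fin t) ℤ} (x₀ : Fin t → ℤ) {m : ℕ} (hm : 0 < m)
    (n : Fin (kerDim A) → ℕ) (i : Fin t) :
    ((paramResidue A x₀ m n i : ℕ) : ℤ) = (paramPoint A x₀ (fun j => (n j : ℤ)) i) % (m : ℤ) :=
  toNat_emod_cast hm _

/-- The reduced parametrisation lands in `Γ_m`. [cite: GreenTao2010, §4 (derivation of Thm. 1.8)] -/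
theorem paramResidue_mem {A : Matrix (Fin s) (Fin t) ℤ} {x₀ : Fin t → ℤ} {b : Fin s → ℤ}
    (hx₀ : A *ᵥ x₀ = b) {m : ℕ} (hm : 0 < m) (n : Fin (kerDim A) → ℕ) :
    paramResidue A x₀ m n ∈ equationResidues A b m := by
  classical
  unfold equationResidues
  rw [Finset.mem_filter, Fintype.mem_piFinset]
  refine ⟨fun i => Finset.mem_range.mpr (toNat_emod_lt hm _),
    paramPoint A x₀ (fun j => (n j : ℤ)), by rw [mulVec_paramPoint, hx₀], fun i => ?_⟩
  rw [paramResidue_cast x₀ hm]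
  exact dvd_sub_emod _ _

/-- The reduced parametrisation is injective on `{0, …, m-1}^{kerDim A}`.
[cite: GreenTao2010, §4 (derivation of Thm. 1.8)] -/
theorem paramResidue_injOn (A : Matrix (Fin s) (Fin t) ℤ) (x₀ : Fin t → ℤ) {m : ℕ} (hm : 0 < m) :
    Set.InjOn (paramResidue A x₀ m)
      ↑(Fintype.piFinset fun _ : Fin (kerDim A) => range m) := by
  classical
  intro n hn n' hn' heq
  rw [Finset.mem_coe, Fintype.mem_piFinset] at hn hn'
  have hm' : (m : ℤ) ≠ 0 := by exact_mod_cast hm.ne'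
  have hdvd : ∀ i, (m : ℤ) ∣ paramPoint A x₀ (fun j => (n j : ℤ)) i -
      paramPoint A x₀ (fun j => (n' j : ℤ)) i := fun i => by
    have hi := congr_fun heq i
    have hc : (paramPoint A x₀ (fun j => (n j : ℤ)) i) % (m : ℤ) =
        (paramPoint A x₀ (fun j => (n' j : ℤ)) i) % (m : ℤ) := by
      rw [← paramResidue_cast x₀ hm, ← paramResidue_cast x₀ hm, hi]
    exact Int.modEq_iff_dvd.mp hc.symm
  have hc := (dvd_paramPoint_sub_iff A x₀ hm' _ _).mp hdvd
  funext j
  have hj := hc j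
  have h1 := Finset.mem_range.mp (hn j)
  have h2 := Finset.mem_range.mp (hn' j)
  have habs : |((n j : ℕ) : ℤ) - ((n' j : ℕ) : ℤ)| < (m : ℤ) := by
    rw [abs_lt]; constructor <;> omega
  have := Int.eq_zero_of_abs_lt_dvd hj habs
  omega

/-- The reduced parametrisation maps onto `Γ_m`. [cite: GreenTao2010, §4 (derivation of Thm. 1.8)] -/
theorem paramResidue_surjOn {A : Matrix (Fin s) (Fin t) ℤ} {x₀ : Fin t → ℤ} {b : Fin s → ℤ}
    (hx₀ : A *ᵥ x₀ = b) {m : ℕ} (hm : 0 < m) :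
    Set.SurjOn (paramResidue A x₀ m) ↑(Fintype.piFinset fun _ : Fin (kerDim A) => range m)
      ↑(equationResidues A b m) := by
  classical
  intro y hy
  rw [Finset.mem_coe, equationResidues, Finset.mem_filter, Fintype.mem_piFinset] at hy
  obtain ⟨hy, x, hx, hxy⟩ := hy
  have hm' : (m : ℤ) ≠ 0 := by exact_mod_cast hm.ne'
  obtain ⟨c₀, hc₀⟩ := exists_paramPoint_eq (x₀ := x₀) (x := x) (by rw [hx, hx₀])
  refine ⟨fun j => ((c₀ j) % (m : ℤ)).toNat, ?_, ?_⟩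
  · rw [Finset.mem_coe, Fintype.mem_piFinset]
    exact fun j => Finset.mem_range.mpr (toNat_emod_lt hm _)
  · funext i
    have hred : ∀ j, (m : ℤ) ∣ (((c₀ j % (m : ℤ)).toNat : ℕ) : ℤ) - c₀ j := fun j => by
      rw [toNat_emod_cast hm, ← neg_sub]
      exact Dvd.dvd.neg_right (dvd_sub_emod _ _)
    have hΨ := (dvd_paramPoint_sub_iff A x₀ hm' (fun j => (((c₀ j % (m : ℤ)).toNat : ℕ) : ℤ)) c₀).mpr
      hred i
    rw [hc₀] at hΨ
    -- `Ψ(n) ≡ x ≡ y (mod m)` and `0 ≤ y i < m`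
    have hyi : (0 : ℤ) ≤ (y i : ℤ) ∧ ((y i : ℕ) : ℤ) < (m : ℤ) :=
      ⟨by positivity, by exact_mod_cast Finset.mem_range.mp (hy i)⟩
    have h1 : (m : ℤ) ∣ paramPoint A x₀ (fun j => (((c₀ j % (m : ℤ)).toNat : ℕ) : ℤ)) i - y i := by
      have := Dvd.dvd.add hΨ (hxy i)
      rwa [sub_add_sub_cancel] at this
    have h2 : ((y i : ℕ) : ℤ) ≡ paramPoint A x₀ (fun j => (((c₀ j % (m : ℤ)).toNat : ℕ) : ℤ)) i
        [ZMOD (m : ℤ)] := Int.modEq_iff_dvd.mpr h1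
    unfold Int.ModEq at h2
    rw [Int.emod_eq_of_lt hyi.1 hyi.2] at h2
    apply Nat.cast_injective (R := ℤ)
    rw [paramResidue_cast x₀ hm, ← h2]

/-- `#Γ_m = m^{kerDim A}`. [cite: GreenTao2010, §4 (derivation of Thm. 1.8)] -/
theorem card_equationResidues {A : Matrix (Fin s) (Fin t) ℤ} {x₀ : Fin t → ℤ} {b : Fin s → ℤ}
    (hx₀ : A *ᵥ x₀ = b) {m : ℕ} (hm : 0 < m) : #(equationResidues A b m) = m ^ kerDim A := by
  classical
  rw [← Finset.card_nbij (paramResidue A x₀ m) (fun n _ => paramResidue_mem hx₀ hm n)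
    (paramResidue_injOn A x₀ hm) (paramResidue_surjOn hx₀ hm), Fintype.card_piFinset]
  simp

/-- **`α_m = β_m(Ψ)`**: the local density of the affine lattice `{Ax = b}` at any modulus `m ≥ 1`
is the local factor (1.6) of its parametrising system, for every base point `x₀ ∈ Γ`
("the map `Ψ : ℤ^d → Γ` is bijective and … this implies `α_p = β_p`").
[cite: GreenTao2010, §4 (derivation of Thm. 1.8)] -/
theorem equationLocalFactor_eq_localFactor {A : Matrix (Fin s) (Fin t) ℤ} {x₀ : Fin t → ℤ}
    {b : Fin s → ℤ} (hx₀ : A *ᵥ x₀ = b) {m : ℕ} (hm : 0 < m) :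
    equationLocalFactor A b m = localFactor (paramSystem A x₀) m := by
  classical
  unfold equationLocalFactor localFactor
  rw [card_equationResidues hx₀ hm]
  push_cast
  congr 1
  refine (Finset.sum_nbij (paramResidue A x₀ m) (fun n _ => paramResidue_mem hx₀ hm n)
    (paramResidue_injOn A x₀ hm) (paramResidue_surjOn hx₀ hm) fun n _ => ?_).symm
  refine Finset.prod_congr rfl fun i _ => ?_
  rw [eval_paramSystem, paramResidue_cast x₀ hm]
  exact localVonMangoldt_congr (by rw [← neg_sub]; exact (dvd_sub_emod _ _).neg_right)

/-- `∏_{p ≤ x} α_p = ∏_{p ≤ x} β_p(Ψ)`. [cite: GreenTao2010, §4 (derivation of Thm. 1.8)] -/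
theorem equationSingularProductPartial_eq {A : Matrix (Fin s) (Fin t) ℤ} {x₀ : Fin t → ℤ}
    {b : Fin s → ℤ} (hx₀ : A *ᵥ x₀ = b) (x : ℕ) :
    equationSingularProductPartial A b x = singularProductPartial (paramSystem A x₀) x := by
  unfold equationSingularProductPartial singularProductPartial
  refine Finset.prod_congr rfl fun p hp => ?_
  exact equationLocalFactor_eq_localFactor hx₀ (Nat.prime_of_mem_primesLE hp).pos

/-- **`∏_p α_p = ∏_p β_p(Ψ)`**. [cite: GreenTao2010, §4 (derivation of Thm. 1.8)] -/
theorem equationSingularProduct_eq {A : Matrix (Fin s) (Fin t) ℤ} {x₀ : Fin t → ℤ}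
    {b : Fin s → ℤ} (hx₀ : A *ᵥ x₀ = b) :
    equationSingularProduct A b = singularProduct (paramSystem A x₀) := by
  unfold equationSingularProduct singularProduct
  rw [show equationSingularProductPartial A b = singularProductPartial (paramSystem A x₀) from
    funext fun x => equationSingularProductPartial_eq hx₀ x]

end Literature.NumberTheory.Sieve

end
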